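import Mathlib.Analysis.InnerProductSpace.PiL2
import Mathlib.Topology.Algebra.InfiniteSum.Basic
import Mathlib.Topology.MetricSpace.Bounded
import Mathlib.Analysis.Normed.Module.FiniteDimension
import HarnessLib

/-!
# Polysticky pair potentials: distance alphabets, scores and the maximal score

Convenience notions for the route `AtomisticToContinuum/Crystallization/PolystickyAlphabet`
(items `stmt-AtomisticToContinuum-5544 … 5548` inline them with `let`; the definitions below are
DEFINITIONALLY those `let`s, so the items need no change). A **distance alphabet** is a finite set
`D ⊂ (0, R)` of allowed distances below the range `R`, with **rewards** `w ≥ 0` supported on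
`{s ∈ D | 2s < R}`; a point set `X ⊆ ℝᵈ` is **admissible** if all distances `< R` between distinct
points of `X` lie in `D`; the **score** of `x ∈ X` is `Σ'_{y ∈ X ∖ {x}} w (dist x y)`; the
**maximal score** is the supremum of scores over admissible `(X, x)`; and the **polysticky
potential** with penalty `P` is `V_P(r) = -w r` on `D`, `P` on the forbidden distances
`(0, R) ∖ D`, `0` beyond `R` — the many-well generalisation of the sticky disc
`V = +∞·1_{(0,1)} - 1_{{1}}` of Heitmann–Radin (1980).

## Contents (all proved; no named facts)

* `Polysticky.IsAlphabet D R w` (the items' standing hypothesis, verbatim), `Polysticky.Admissible`,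
  `Polysticky.score`, `Polysticky.scoreSet`, `Polysticky.maxScore`, `Polysticky.potential`,
  `Polysticky.sep D R` (the separation constant `min R (min D)`);
* API: `Admissible.mono`, `admissible_empty/singleton`, uniform discreteness
  `Admissible.sep_le_dist` with `sep_pos`; `score_empty_eq`, `zero_mem_scoreSet`,
  `scoreSet_nonempty`; the potential: `potential_of_mem`, `potential_of_forbidden`,
  `potential_eq_zero_of_le` (finite range), `potential_bddBelow` (lower bound `min (-B) (min P 0)`
  for any bound `w ≤ B` on `D`), `range_potential_finite` (finitely many values).

Not here: finiteness of the score support / `BddAbove scoreSet` / attainment of `maxScore` (packing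
arguments; they are the content of the route item `PolystickyChargingBound`).

## References

* R. C. Heitmann, C. Radin, *The ground state for sticky disks*, J. Stat. Phys. 22 (1980) 281–287
  (the one-well case). [HeitmannRadin1980]
* X. Blanc, M. Lewin, *The crystallization conjecture: a review*, EMS Surv. Math. Sci. 2 (2015).
-/

noncomputable section

open Set Metric

namespace Literature.MathematicalPhysics.StatisticalMechanics.Polysticky

variable {α : Type*} [PseudoMetricSpace α]

/-- **Distance alphabet with rewards** (the standing hypothesis of the route items, verbatim):
`D ⊂ (0, R)`, `w ≥ 0`, `w` supported on `{s ∈ D | 2s < R}`, `w ≢ 0`. [folklore] -/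
def IsAlphabet (D : Finset ℝ) (R : ℝ) (w : ℝ → ℝ) : Prop :=
  (∀ s ∈ D, 0 < s ∧ s < R) ∧ (∀ s, 0 ≤ w s) ∧ (∀ s, w s ≠ 0 → s ∈ D ∧ 2 * s < R) ∧ (∃ s, 0 < w s)

/-- **Admissible point set**: all distances `< R` between distinct points lie in the alphabet `D`
(definitionally the items' `adm`). [folklore] -/
def Admissible (D : Finset ℝ) (R : ℝ) (X : Set α) : Prop :=
  ∀ x ∈ X, ∀ y ∈ X, x ≠ y → dist x y < R → dist x y ∈ D

/-- **Score** of a point: `Σ'_{y ∈ X, y ≠ x} w (dist x y)` (unconditional sum; definitionally the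
items' `score`). [folklore] -/
def score (w : ℝ → ℝ) (X : Set α) (x : α) : ℝ :=
  ∑' y : {y : α // y ∈ X ∧ y ≠ x}, w (dist x y.1)

variable (α) in
/-- The set of scores of points of admissible configurations in `α` (the items' `S`). [folklore] -/
def scoreSet (D : Finset ℝ) (R : ℝ) (w : ℝ → ℝ) : Set ℝ :=
  {s : ℝ | ∃ X : Set α, Admissible D R X ∧ ∃ x ∈ X, s = score w X x}

variable (α) in
/-- **Maximal score** `M = sup` of the score set (the items' `M`; `sSup` junk `0` if unbounded or
empty, which the alphabet hypotheses exclude). [folklore] -/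
def maxScore (D : Finset ℝ) (R : ℝ) (w : ℝ → ℝ) : ℝ :=
  sSup (scoreSet α D R w)

/-- **Polysticky pair potential with penalty `P`**: reward `-w r` on the alphabet, penalty `P` on the
forbidden distances `0 < r < R`, `r ∉ D`, and `0` otherwise (definitionally the items' `V`); the
one-well case `D = {1}` is Heitmann–Radin's sticky disc with a finite penalty.
[cite: HeitmannRadin1980, §1 (sticky potential)] -/
def potential (D : Finset ℝ) (R : ℝ) (w : ℝ → ℝ) (P : ℝ) : ℝ → ℝ :=
  fun r => if r ∈ D then -w r else if 0 < r ∧ r < R then P else 0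

/-- The **separation constant** of an alphabet: `min R (min D)` (`R` if `D = ∅`). [folklore] -/
def sep (D : Finset ℝ) (R : ℝ) : ℝ :=
  if h : D.Nonempty then min R (D.min' h) else R

/-! ### Admissible sets -/

section Admissible

variable {D : Finset ℝ} {R : ℝ} {X Y : Set α}

/-- Subsets of admissible sets are admissible. [folklore] -/
theorem Admissible.mono (h : Admissible D R X) (hYX : Y ⊆ X) : Admissible D R Y :=
  fun x hx y hy hne hlt => h x (hYX hx) y (hYX hy) hne hlt

/-- The empty set is admissible. [folklore] -/
theorem admissible_empty : Admissible D R (∅ : Set α) := fun _ hx => hx.elim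

/-- Singletons are admissible. [folklore] -/
theorem admissible_singleton (x : α) : Admissible D R ({x} : Set α) := by
  intro a ha b hb hne
  rw [mem_singleton_iff] at ha hb
  exact absurd (ha.trans hb.symm) hne

/-- The separation constant is at most `R`. [folklore] -/
theorem sep_le (D : Finset ℝ) (R : ℝ) : sep D R ≤ R := by
  unfold sep
  split_ifs
  · exact min_le_left _ _
  · exact le_rfl

/-- The separation constant is at most every letter of the alphabet. [folklore] -/
theorem sep_le_of_mem {s : ℝ} (hs : s ∈ D) : sep D R ≤ s := by
  unfold sep
  rw [dif_pos ⟨s, hs⟩]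
  exact (min_le_right _ _).trans (D.min'_le s hs)

/-- For an alphabet `D ⊂ (0, R)` with `R > 0` the separation constant is positive. [folklore] -/
theorem sep_pos (hD : ∀ s ∈ D, 0 < s ∧ s < R) (hR : 0 < R) : 0 < sep D R := by
  unfold sep
  split_ifs with h
  · exact lt_min hR (hD _ (D.min'_mem h)).1
  · exact hR

/-- An alphabet with a non-trivial reward has positive range `R`. [folklore] -/
theorem IsAlphabet.range_pos {w : ℝ → ℝ} (h : IsAlphabet D R w) : 0 < R := by
  obtain ⟨hD, -, hsupp, s, hs⟩ := h
  have hsD := (hsupp s hs.ne').1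
  exact (hD s hsD).1.trans (hD s hsD).2

/-- An alphabet with a non-trivial reward has positive separation constant. [folklore] -/
theorem IsAlphabet.sep_pos {w : ℝ → ℝ} (h : IsAlphabet D R w) : 0 < sep D R :=
  Polysticky.sep_pos h.1 h.range_pos

/-- **Uniform discreteness**: distinct points of an admissible set are at distance `≥ sep D R`
(either `≥ R`, or the distance is a letter of `D`). [folklore] -/
theorem Admissible.sep_le_dist (h : Admissible D R X) {x y : α} (hx : x ∈ X) (hy : y ∈ X)
    (hne : x ≠ y) : sep D R ≤ dist x y := by
  by_cases hlt : dist x y < R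
  · exact sep_le_of_mem (h x hx y hy hne hlt)
  · exact (sep_le D R).trans (not_lt.1 hlt)

end Admissible

/-! ### Scores -/

section Score

variable {D : Finset ℝ} {R : ℝ} {w : ℝ → ℝ}

/-- A point with no other point of `X` has score `0`. [folklore] -/
theorem score_eq_zero_of_subsingleton {X : Set α} {x : α} (h : ∀ y ∈ X, y = x) :
    score w X x = 0 := by
  unfold score
  haveI : IsEmpty {y : α // y ∈ X ∧ y ≠ x} := ⟨fun y => y.2.2 (h y.1 y.2.1)⟩
  exact tsum_empty

/-- The score of the point of a singleton is `0`. [folklore] -/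
theorem score_singleton (x : α) : score w ({x} : Set α) x = 0 :=
  score_eq_zero_of_subsingleton fun _ hy => hy

/-- Scores are non-negative for non-negative rewards. [folklore] -/
theorem score_nonneg (hw : ∀ s, 0 ≤ w s) (X : Set α) (x : α) : 0 ≤ score w X x :=
  tsum_nonneg fun _ => hw _

/-- `0` is a score (of the point of a singleton), in any inhabited space. [folklore] -/
theorem zero_mem_scoreSet [Nonempty α] : (0 : ℝ) ∈ scoreSet α D R w := by
  obtain ⟨x⟩ := ‹Nonempty α›
  exact ⟨{x}, admissible_singleton x, x, rfl, (score_singleton x).symm⟩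

/-- The score set is non-empty (in an inhabited space). [folklore] -/
theorem scoreSet_nonempty [Nonempty α] : (scoreSet α D R w).Nonempty :=
  ⟨0, zero_mem_scoreSet⟩

/-- Every score of an admissible configuration is at most the maximal score, provided the score
set is bounded above (which is part of the route item `PolystickyChargingBound`). [folklore] -/
theorem score_le_maxScore {X : Set α} (hX : Admissible D R X) {x : α} (hx : x ∈ X)
    (hbdd : BddAbove (scoreSet α D R w)) : score w X x ≤ maxScore α D R w :=
  le_csSup hbdd ⟨X, hX, x, hx, rfl⟩

/-- The maximal score is non-negative when the score set is bounded above. [folklore] -/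
theorem maxScore_nonneg [Nonempty α] (hbdd : BddAbove (scoreSet α D R w)) : 0 ≤ maxScore α D R w :=
  le_csSup hbdd zero_mem_scoreSet

end Score

/-! ### The polysticky potential -/

section Potential

variable {D : Finset ℝ} {R P : ℝ} {w : ℝ → ℝ}

/-- On the alphabet the potential is the reward `-w r`. [folklore] -/
theorem potential_of_mem {r : ℝ} (hr : r ∈ D) : potential D R w P r = -w r := by
  simp [potential, hr]

/-- On forbidden distances below the range the potential is the penalty `P`. [folklore] -/
theorem potential_of_forbidden {r : ℝ} (hr : r ∉ D) (h0 : 0 < r) (hR : r < R) :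
    potential D R w P r = P := by
  simp [potential, hr, h0, hR]

/-- Beyond the range (and off the alphabet) the potential vanishes. [folklore] -/
theorem potential_of_le {r : ℝ} (hr : r ∉ D) (hR : R ≤ r) : potential D R w P r = 0 := by
  simp [potential, hr, not_lt.2 hR]

/-- **Finite range**: for an alphabet `D ⊂ (0, R)` the potential vanishes on `[R, ∞)`. [folklore] -/
theorem potential_eq_zero_of_le (hD : ∀ s ∈ D, 0 < s ∧ s < R) {r : ℝ} (hR : R ≤ r) :
    potential D R w P r = 0 :=
  potential_of_le (fun hr => (not_lt.2 hR) (hD r hr).2) hR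

/-- The potential has finite range `R`. [folklore] -/
theorem potential_finiteRange (hD : ∀ s ∈ D, 0 < s ∧ s < R) :
    ∃ R₀ : ℝ, ∀ r, R₀ ≤ r → potential D R w P r = 0 :=
  ⟨R, fun _ hr => potential_eq_zero_of_le hD hr⟩

/-- **Lower bound**: if `w ≤ B` on `D` then `min (-B) (min P 0) ≤ V_P`. [folklore] -/
theorem potential_ge {B : ℝ} (hB : ∀ s ∈ D, w s ≤ B) (r : ℝ) :
    min (-B) (min P 0) ≤ potential D R w P r := by
  unfold potential
  split_ifs with h1 h2
  · exact (min_le_left _ _).trans (neg_le_neg (hB r h1))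
  · exact (min_le_right _ _).trans (min_le_left _ _)
  · exact (min_le_right _ _).trans (min_le_right _ _)

/-- The potential is bounded below (the items' clause `∃ c, ∀ r, c ≤ V r`), with the explicit
constant `min (-Σ_{s ∈ D} |w s|) (min P 0)`. [folklore] -/
theorem potential_bddBelow : ∃ c : ℝ, ∀ r, c ≤ potential D R w P r :=
  ⟨min (-∑ s ∈ D, |w s|) (min P 0), potential_ge fun s hs =>
    (le_abs_self (w s)).trans (Finset.single_le_sum (fun t _ => abs_nonneg (w t)) hs)⟩

/-- **Finitely many values**: the potential takes values in `{-w s | s ∈ D} ∪ {P, 0}` (so the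
existence of finite-`N` ground states reduces to the route item `FiniteValuedGroundStates`). [folklore] -/
theorem range_potential_subset :
    range (potential D R w P) ⊆ ↑(D.image fun s => -w s) ∪ {P, 0} := by
  rintro _ ⟨r, rfl⟩
  unfold potential
  split_ifs with h1 h2
  · exact Or.inl (Finset.mem_coe.2 (Finset.mem_image.2 ⟨r, h1, rfl⟩))
  · exact Or.inr (Or.inl rfl)
  · exact Or.inr (Or.inr rfl)

/-- The potential takes finitely many values. [folklore] -/
theorem range_potential_finite : (range (potential D R w P)).Finite :=
  ((Finset.finite_toSet _).union ((finite_singleton _).insert P)).subset range_potential_subset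

end Potential

end Literature.MathematicalPhysics.StatisticalMechanics.Polysticky

end
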